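import Literature.AlgebraicGeometry.Deligne1982.WeilTypeCMFieldIsCM
import Mathlib.FieldTheory.IntermediateField.Algebraic
import Mathlib.FieldTheory.IsAlgClosed.Basic
import Mathlib.Analysis.Complex.Polynomial.Basic
import HarnessLib

/-!
# Ring 2 — Weil-type family-coverage census, CM-field rows (X-AD): `R(T²)` IS IRREDUCIBLE whenever `R` is irreducible
# with real negative roots — the field instance of EVERY Deligne carrier `E = ℚ[T]/(R(T²))` without an Eisenstein prime

HONEST FRAMING: research route conditional on HC_CM; not a corollary; Q11.4-sentence-2 already refuted in dim ≥ 3.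

Cell `pub-hodge-ring2`, seat `ring2-b03` (gen 59), census `WEIL-FAMILY-COVERAGE.md` «## b03» b03.24 P.S. The kernel files of
the census present a CM field as `E = cmField R = ℚ[T]/(R(T²))` over `F = realField R = ℚ[S]/(R)` and need the two
instances `Fact (Irreducible (realPolyQ R))`, `Fact (Irreducible (cmPolyQ R))`. So far the second was obtained case by
case from an Eisenstein prime of `R(T²)` (parts I, X-V: `ℚ(ζ₅)`, `ℚ(ζ₇)`, `ℚ(ζ₉)`) or by the factor-exclusion engine of
part X-J (quartic `E`); the composite sextic carriers of b03.23 (`ℚ(ζ₇)⁺(i)`: `R = S³ + 5S² + 6S + 1`, …) have no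
Eisenstein prime. This part proves the GENERAL statement — the converse of the tree's
`Deligne1982.irreducible_of_irreducible_comp_X_sq`:

* **`irreducible_cmPolyQ_of_roots_real_neg`**: if `R` is monic, `R` is irreducible over `ℚ` and every complex root of
  `R` is real and negative (the standing hypothesis `hroots` of `IsWeilTypeCM` / `Deligne1982.isCMField_cmField`), then
  `R(T²)` is irreducible over `ℚ`. PROOF (degrees): for a complex root `α` of `R(T²)`, `β = α²` is a root of `R`, so
  real negative, hence `α ∉ ℝ`; `[ℚ(β):ℚ] = deg R = d` divides `[ℚ(α):ℚ] = e ≤ 2d` (`ℚ(β) ⊆ ℚ(α)`, `minpoly α ∣ R(T²)`),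
  and `e ≠ d` since `ℚ(β) ⊂ ℝ ∌ α`; so `e = 2d` and `minpoly_ℚ(α) = R(T²)`.
* `fact_irreducible_cmPolyQ_of_roots_real_neg` — the `Fact` packaging consumed by the census files (parts X-Z…X-AC).

THEOREMS ONLY: no `def`, no named fact, no `sorry`; `HC_CM` does not occur; nothing about the Hodge conjecture is
asserted.

## References
* [Deligne1982HodgeCycles] P. Deligne (notes by J. S. Milne), LNM 900 (1982), §4 p. 30 ("`E = F(η)`, `η² ∈ F` totally
  negative").
-/

noncomputable section

set_option linter.dupNamespace false

open Polynomial

namespace Summit.HodgeConjecture.HodgeConjecture.Ring2.WeilCoverageCM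

open Literature.AlgebraicGeometry.Deligne1982

/-- **`R(T²)` is irreducible over `ℚ` when `R` is monic irreducible with real negative roots.** For a complex root `α`
of `R(T²)`: `β = α²` is a root of `R`, so `β ∈ ℝ_{<0}` and `α ∈ iℝ ∖ {0}`; `d = [ℚ(β):ℚ]` divides `e = [ℚ(α):ℚ] ≤ 2d` and
`e ≠ d` because `ℚ(β) ⊂ ℝ`; hence `e = 2d` and the minimal polynomial of `α` is `R(T²)` itself.
[cite: Deligne1982HodgeCycles, §4 p. 30] -/
theorem irreducible_cmPolyQ_of_roots_real_neg {R : Polynomial ℤ} (hmonic : R.Monic)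
    (hirr : Irreducible (realPolyQ R))
    (hR : ∀ s : ℂ, Polynomial.eval₂ (Int.castRingHom ℂ) s R = 0 → s.im = 0 ∧ s.re < 0) :
    Irreducible (cmPolyQ R) := by
  classical
  -- degrees and monicity
  have hQm : (realPolyQ R).Monic := hmonic.map _
  have hd : 0 < (realPolyQ R).natDegree := natDegree_pos_iff_degree_pos.2 (degree_pos_of_irreducible hirr)
  have hPQ : cmPolyQ R = (realPolyQ R).comp (X ^ 2) := cmPolyQ_eq_comp R
  have hPm : (cmPolyQ R).Monic := by
    rw [hPQ]
    exact hQm.comp (monic_X_pow 2) (by rw [natDegree_X_pow]; norm_num)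
  have hPdeg : (cmPolyQ R).natDegree = 2 * (realPolyQ R).natDegree := by
    rw [hPQ, natDegree_comp, natDegree_X_pow, mul_comm]
  -- a complex root `α` of `R(T²)`; `β = α²` is a root of `R`
  obtain ⟨α, hα⟩ : ∃ α : ℂ, aeval α (cmPolyQ R) = 0 :=
    IsAlgClosed.exists_aeval_eq_zero ℂ (cmPolyQ R) (by
      rw [degree_eq_natDegree hPm.ne_zero, hPdeg]
      exact_mod_cast (by omega : 2 * (realPolyQ R).natDegree ≠ 0))
  have hβ : aeval (α ^ 2) (realPolyQ R) = 0 := by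
    rw [hPQ, aeval_comp, aeval_X_pow] at hα
    exact hα
  have hβR : Polynomial.eval₂ (Int.castRingHom ℂ) (α ^ 2) R = 0 := by
    have h := hβ
    rwa [aeval_def, show realPolyQ R = R.map (Int.castRingHom ℚ) from rfl, eval₂_map,
      RingHom.eq_intCast' ((algebraMap ℚ ℂ).comp (Int.castRingHom ℚ))] at h
  obtain ⟨hβim, hβre⟩ := hR (α ^ 2) hβR
  -- `α` is purely imaginary and non-zero
  have him2 : (α ^ 2).im = 2 * α.re * α.im := by rw [sq, Complex.mul_im]; ring
  have hre2 : (α ^ 2).re = α.re ^ 2 - α.im ^ 2 := by rw [sq, Complex.mul_re]; ring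
  have hαre : α.re = 0 := by
    rcases mul_eq_zero.1 (show α.re * α.im = 0 by linarith [hβim, him2]) with h | h
    · exact h
    · exfalso
      rw [h] at hre2
      nlinarith [hβre, hre2, sq_nonneg α.re]
  have hαim : α.im ≠ 0 := by
    intro h
    rw [h, hαre] at hre2
    linarith [hβre, hre2]
  -- integrality, minimal polynomials
  have hintα : IsIntegral ℚ α := ⟨cmPolyQ R, hPm, by rw [← aeval_def]; exact hα⟩
  have hintβ : IsIntegral ℚ (α ^ 2) := ⟨realPolyQ R, hQm, by rw [← aeval_def]; exact hβ⟩
  have hminβ : minpoly ℚ (α ^ 2) = realPolyQ R := (minpoly.eq_of_irreducible_of_monic hirr hβ hQm).symm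
  have hdvd : minpoly ℚ α ∣ cmPolyQ R := minpoly.dvd ℚ α hα
  -- the fields `ℚ(β) ≤ ℚ(α)`
  have hle : IntermediateField.adjoin ℚ {α ^ 2} ≤ IntermediateField.adjoin ℚ {α} := by
    rw [IntermediateField.adjoin_simple_le_iff]
    exact pow_mem (IntermediateField.mem_adjoin_simple_self ℚ α) 2
  haveI : FiniteDimensional ℚ (IntermediateField.adjoin ℚ {α}) := IntermediateField.adjoin.finiteDimensional hintα
  have hfinβ : Module.finrank ℚ (IntermediateField.adjoin ℚ {α ^ 2}) = (realPolyQ R).natDegree := by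
    rw [IntermediateField.adjoin.finrank hintβ, hminβ]
  have hfinα : Module.finrank ℚ (IntermediateField.adjoin ℚ {α}) = (minpoly ℚ α).natDegree :=
    IntermediateField.adjoin.finrank hintα
  -- `d ∣ e`, `e ≤ 2d`
  have hdvd_deg : (realPolyQ R).natDegree ∣ (minpoly ℚ α).natDegree := by
    rw [← hfinβ, ← hfinα]
    exact IntermediateField.finrank_dvd_of_le_right hle
  have hle_deg : (minpoly ℚ α).natDegree ≤ 2 * (realPolyQ R).natDegree := by
    rw [← hPdeg]
    exact natDegree_le_of_dvd hdvd hPm.ne_zero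
  -- `e ≠ d`: otherwise `ℚ(β) = ℚ(α)` and `α` would be real
  have hne_deg : (minpoly ℚ α).natDegree ≠ (realPolyQ R).natDegree := by
    intro he
    have heq : IntermediateField.adjoin ℚ {α ^ 2} = IntermediateField.adjoin ℚ {α} :=
      IntermediateField.eq_of_le_of_finrank_eq hle (by rw [hfinβ, hfinα, he])
    -- the real subfield of `ℂ`
    let Re : IntermediateField ℚ ℂ := Subfield.toIntermediateField Complex.ofRealHom.fieldRange
      (fun q => ⟨(q : ℝ), by simp⟩)
    have hβRe : α ^ 2 ∈ Re := ⟨(α ^ 2).re, Complex.ext (by simp) (by simp [hβim])⟩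
    have hαRe : α ∈ Re := by
      have h1 : IntermediateField.adjoin ℚ {α} ≤ Re := by
        rw [← heq, IntermediateField.adjoin_simple_le_iff]
        exact hβRe
      exact h1 (IntermediateField.mem_adjoin_simple_self ℚ α)
    obtain ⟨r, hr⟩ := hαRe
    apply hαim
    rw [← hr]
    exact Complex.ofReal_im r
  -- hence `e = 2d` and `minpoly α = R(T²)`
  have he : (minpoly ℚ α).natDegree = 2 * (realPolyQ R).natDegree := by
    obtain ⟨k, hk⟩ := hdvd_deg
    have hk2 : k ≤ 2 := by
      by_contra hk3
      have : (realPolyQ R).natDegree * 3 ≤ (realPolyQ R).natDegree * k := Nat.mul_le_mul_left _ (by omega)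
      rw [← hk] at this
      omega
    interval_cases k
    · exfalso
      rw [mul_zero] at hk
      exact (minpoly.natDegree_pos hintα).ne' hk
    · exfalso
      rw [mul_one] at hk
      exact hne_deg hk
    · rw [hk, mul_comm]
  have hPeq : minpoly ℚ α = cmPolyQ R :=
    eq_of_dvd_of_natDegree_le_of_leadingCoeff hdvd (by rw [hPdeg, he])
      (by rw [(minpoly.monic hintα).leadingCoeff, hPm.leadingCoeff])
  rw [← hPeq]
  exact minpoly.irreducible hintα

/-- The `Fact` packaging: **`E = ℚ[T]/(R(T²))` is a field** as soon as `F = ℚ[S]/(R)` is one, `R` is monic and the roots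
of `R` are real negative — no Eisenstein prime needed. [cite: Deligne1982HodgeCycles, §4 p. 30] -/
theorem fact_irreducible_cmPolyQ_of_roots_real_neg {R : Polynomial ℤ} (hmonic : R.Monic)
    [h : Fact (Irreducible (realPolyQ R))]
    (hR : ∀ s : ℂ, Polynomial.eval₂ (Int.castRingHom ℂ) s R = 0 → s.im = 0 ∧ s.re < 0) :
    Fact (Irreducible (cmPolyQ R)) :=
  ⟨irreducible_cmPolyQ_of_roots_real_neg hmonic h.out hR⟩

end Summit.HodgeConjecture.HodgeConjecture.Ring2.WeilCoverageCM

end
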